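import Summits.AtomisticToContinuum.Crystallization.Theorems.FreeSplittingCertificatesStrictSplittingRuleP1FarCellShare

/-!
# `StrictSplittingRule` (stmt-AtomisticToContinuum-12560): the exact radial defect against the CIRCUMRADIUS table; an unloaded cell meets its budget (P1 interpolant object, part 97)

Route `FreeSplittingCertificates`, crux r3 `StrictSplittingRule` (H12⋆ = `stub_coreJointCoercive`), unit b2b-freesplit-B gen 40.
VALUE = fourth brick of the sharper (B∃) tail lemma + the closure of a gap found in the gen-40 audit of (B∃_fin).
* **`p1CellDefectG_far_le_circ`** — part 85's far-cell defect bound with the circumradius table of part 52 (`ρ_T ≤ a²/3 + h²/4`) in place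
  of the star radius `4a²/3 + h²` (a factor `≈ 4`): `defect ≤ c(a²/3 + h²/4)/((R − 3/2)²a²)·|G|²_F·J_T` for cells `≥ Ra`, `R ≥ 7`;
* **`defect_only_budget`** — EVERY cell, at any position, meets the per-cell budget of (B∃) by its defect alone when it carries no load:
  `χ ≡ 0` below `81a/20`, so `cχ²s⁻⁴ ≤ (c/(81a/20)²)χ²s⁻³` pointwise and `defect ≤ 0.1118·|G|²_F·J_T ≤ κ(5/48)|G|²_F·J_T`.  The
  per-cell certifier (cellval.py) lists only cells whose far weight integral is positive IN FLOAT; the gen-40 coverage check (HOME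
  `code/partB/gen40-lean/check40.py`) finds, per representative, 1 630 cells inside the `χ = 0` ball and 24 (A) / 60 (B) slivers with one
  vertex at `√17·a = 4.123a > 81a/20` outside every list — unloaded under the certified allocation (orphans = 0), hence covered by this
  lemma; part 98's endpoint asks the budget for LOADED cells only.
NOT a proof of H12⋆, NOT summit progress.  [folklore]
-/

noncomputable section

open Set Function Metric MeasureTheory Filter Topology
open scoped BigOperators NNReal ENNReal Classical

namespace Summit.AtomisticToContinuum.Crystallization.Theorems.StrictSplittingRuleBirth

open Literature.MathematicalPhysics.StatisticalMechanics
open Summit.AtomisticToContinuum.Crystallization.Theorems.PalmUnimodularRigidity.LayeredLawsSelectHcp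

/-! ## The exact radial defect against the circumradius table -/

/-- **The radial defect of a far cell, CIRCUMRADIUS form**: if all four vertices of `T` are `≥ R·a` from `y_p` (`R ≥ 7`), then for the radial
weight `c·χ²s⁻⁵xxᵀ` (`c ≥ 0`, `0.8a ≤ h ≤ 9a/10`): `p1CellDefectG ≤ c·(a²/3 + h²/4)/((R − 3/2)²a²)·|G|²_F·J_T` — part 85's bound with the
circumradius table of part 52 (`ρ_T ≤ a²/3 + h²/4`) in place of the star radius `4a²/3 + h²` (a factor `≈ 4`). [folklore] -/
theorem p1CellDefectG_far_le_circ {a h c R : ℝ} (ha : 0 < a) (hh : 0 < h) (hha : h ≤ 9 / 10 * a) (hah : 4 / 5 * a ≤ h) (hc : 0 ≤ c)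
    (hR7 : 7 ≤ R) (p : ℤ × ℤ × ℤ) (T : (ℤ × ℤ × ℤ) × Fin 6)
    (hfar : ∀ m : Fin 4, R * a ≤ ‖hcpSite a h (T.1 + p1VertOff (p1Par T.1) T.2 m) - hcpSite a h p‖)
    (G : Fin 3 → Fin 3 → ℝ) :
    p1CellDefectG a h (fun y k l => c * fpChi ((81 / 20 * a) ^ 2) ((27 / 5 * a) ^ 2) (y - fun k => hcpSite a h p k) ^ 2 *
        (fpSq (y - fun k => hcpSite a h p k))⁻¹ ^ 5 * ((y - fun k => hcpSite a h p k) k * (y - fun k => hcpSite a h p k) l)) T G ≤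
      c * (a ^ 2 / 3 + h ^ 2 / 4) / ((R - 3 / 2) ^ 2 * a ^ 2) * fpFrob G * p1CellJ a h p T := by
  have hS1 : (0 : ℝ) < (81 / 20 * a) ^ 2 := by positivity
  have hS12 : (81 / 20 * a) ^ 2 < (27 / 5 * a) ^ 2 := by nlinarith
  set y₀ : Fin 3 → ℝ := fun k => hcpSite a h p k with hy₀
  set W : (Fin 3 → ℝ) → Fin 3 → Fin 3 → ℝ := fun y k l => c * fpChi ((81 / 20 * a) ^ 2) ((27 / 5 * a) ^ 2) (y - y₀) ^ 2 *
    (fpSq (y - y₀))⁻¹ ^ 5 * ((y - y₀) k * (y - y₀) l) with hW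
  have hWc : ∀ k l, Continuous fun y => W y k l := continuous_radWeight_translate hS1 hS12 c y₀
  have hW0 : ∀ y ∈ p1RealCell a h T, ∀ u, 0 ≤ p1Quad3 (W y) u := fun y _ u => p1Quad3_radWeight_nonneg hc _ _ (y - y₀) u
  have hωc := continuous_bareMajorant_translate hS1 hS12 c y₀
  have hω : ∀ y ∈ p1RealCell a h T, ∀ u : Fin 3 → ℝ, p1Quad3 (W y) u ≤
      (c * fpChi ((81 / 20 * a) ^ 2) ((27 / 5 * a) ^ 2) (y - y₀) ^ 2 * (fpSq (y - y₀))⁻¹ ^ 4) * (u 0 ^ 2 + u 1 ^ 2 + u 2 ^ 2) :=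
    fun y _ u => p1Quad3_radWeight_le hc _ _ (y - y₀) u
  -- the circumcentre of part 52, radius² ≤ a²/3 + h²/4
  obtain ⟨cc, hcc⟩ := exists_p1CellCenter a h hh.ne' T
  have hρ : ∀ m : Fin 4, fpSq (fun k => hcpSite a h (T.1 + p1VertOff (p1Par T.1) T.2 m) k - cc k) ≤ a ^ 2 / 3 + h ^ 2 / 4 := by
    intro m
    refine (hcc m).trans ?_
    split_ifs
    · have hz : ((h ^ 2 - a ^ 2 / 3) / (2 * h)) ^ 2 ≤ h ^ 2 / 4 := by
        rw [div_pow, div_le_div_iff₀ (by positivity) (by positivity)]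
        have h1 : 0 ≤ h ^ 2 - a ^ 2 / 3 := by nlinarith
        have h2 : h ^ 2 - a ^ 2 / 3 ≤ h ^ 2 := by nlinarith
        nlinarith [mul_le_mul h2 h2 h1 (by positivity)]
      linarith
    · exact le_rfl
  have hdef := p1CellDefectG_le_rad ha hh T W hWc hW0 hωc hω G hρ
  -- the majorant integral against `J_T` (star radius about vertex 0 for `s_min`, as in part 85)
  set z : ℤ × ℤ × ℤ := T.1 + p1VertOff (p1Par T.1) T.2 0 with hz
  set o : ℤ × ℤ × ℤ := p1VertOff (p1Par T.1) T.2 0 with ho_def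
  have ho : o ∈ p1Corners := p1VertOff_mem_p1Corners _ _ _
  have hzo : z - o = T.1 := by rw [hz]; abel
  have hv : p1VertOff (p1Par (z - o)) T.2 0 = o := by rw [hzo]
  have hTeq : T = (z - o, T.2) := by rw [hzo]
  set ϱ := √(4 * a ^ 2 / 3 + h ^ 2) with hϱ_def
  have hϱ0 : 0 ≤ ϱ := Real.sqrt_nonneg _
  have hϱle : ϱ ≤ 3 / 2 * a := by
    rw [hϱ_def, show 3 / 2 * a = √((3 / 2 * a) ^ 2) by rw [Real.sqrt_sq (by positivity)]]
    exact Real.sqrt_le_sqrt (by nlinarith)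
  set Rz := ‖hcpSite a h z - hcpSite a h p‖ with hRz
  have hRz0 : 0 ≤ Rz := norm_nonneg _
  have hRa : R * a ≤ Rz := hfar 0
  have hsmin : 0 < (R - 3 / 2) ^ 2 * a ^ 2 := by
    have : 0 < R - 3 / 2 := by linarith
    positivity
  set d : Fin 3 → ℝ := fun k => hcpSite a h z k - hcpSite a h p k with hd_def
  have hd : fpSq d = Rz ^ 2 := by rw [hRz, norm_sq_eq_three]; simp [fpSq, hd_def]
  have hK := isCompact_p1RealCell ha.ne' hh.ne' T
  have hmeas : MeasurableSet (p1RealCell a h T) := (isClosed_p1RealCell a h T).measurableSet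
  have hpt : ∀ y ∈ p1RealCell a h T, c * fpChi ((81 / 20 * a) ^ 2) ((27 / 5 * a) ^ 2) (y - y₀) ^ 2 * (fpSq (y - y₀))⁻¹ ^ 4 ≤
      c / ((R - 3 / 2) ^ 2 * a ^ 2) * (fpChi ((81 / 20 * a) ^ 2) ((27 / 5 * a) ^ 2) (y - y₀) ^ 2 * (fpSq (y - y₀))⁻¹ ^ 3) := by
    intro y hy
    set u : Fin 3 → ℝ := fun k => y k - hcpSite a h z k with hu_def
    have hy' : y ∈ p1RealCell a h (z - o, T.2) := hTeq ▸ hy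
    have hu : fpSq u ≤ ϱ ^ 2 := by
      rw [hϱ_def, starRad_sq]; exact fpSq_sub_le_of_mem_starCell ha.ne' hh.ne' z ho hv hy'
    have hx : (y - y₀) = d + u := by funext k; simp [hd_def, hu_def, hy₀]
    rw [hx]
    have hlo := sq_le_fpSq_add hϱ0 (by nlinarith) hd hu
    have hlo' : (R - 3 / 2) ^ 2 * a ^ 2 ≤ fpSq (d + u) := by
      have h1 : (R - 3 / 2) * a ≤ Rz - ϱ := by nlinarith
      have h2 : ((R - 3 / 2) * a) ^ 2 ≤ (Rz - ϱ) ^ 2 := pow_le_pow_left₀ (by nlinarith) h1 2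
      nlinarith
    have hpos : 0 < fpSq (d + u) := lt_of_lt_of_le hsmin hlo'
    have hinv : (fpSq (d + u))⁻¹ ≤ ((R - 3 / 2) ^ 2 * a ^ 2)⁻¹ := by rw [inv_le_inv₀ hpos hsmin]; exact hlo'
    have hχ0 : 0 ≤ c * fpChi ((81 / 20 * a) ^ 2) ((27 / 5 * a) ^ 2) (d + u) ^ 2 * (fpSq (d + u))⁻¹ ^ 3 := by
      have := fpSq_nonneg (d + u); positivity
    calc c * fpChi ((81 / 20 * a) ^ 2) ((27 / 5 * a) ^ 2) (d + u) ^ 2 * (fpSq (d + u))⁻¹ ^ 4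
        = (c * fpChi ((81 / 20 * a) ^ 2) ((27 / 5 * a) ^ 2) (d + u) ^ 2 * (fpSq (d + u))⁻¹ ^ 3) * (fpSq (d + u))⁻¹ := by ring
      _ ≤ (c * fpChi ((81 / 20 * a) ^ 2) ((27 / 5 * a) ^ 2) (d + u) ^ 2 * (fpSq (d + u))⁻¹ ^ 3) * ((R - 3 / 2) ^ 2 * a ^ 2)⁻¹ :=
          mul_le_mul_of_nonneg_left hinv hχ0
      _ = c / ((R - 3 / 2) ^ 2 * a ^ 2) * (fpChi ((81 / 20 * a) ^ 2) ((27 / 5 * a) ^ 2) (d + u) ^ 2 * (fpSq (d + u))⁻¹ ^ 3) := by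
          rw [div_eq_mul_inv]; ring
  have hint3 : IntegrableOn (fun y : Fin 3 → ℝ => c / ((R - 3 / 2) ^ 2 * a ^ 2) *
      (fpChi ((81 / 20 * a) ^ 2) ((27 / 5 * a) ^ 2) (y - y₀) ^ 2 * (fpSq (y - y₀))⁻¹ ^ 3)) (p1RealCell a h T) volume :=
    (continuous_const.mul (continuous_capIntegrand ha y₀)).continuousOn.integrableOn_compact hK
  have hint4 : IntegrableOn (fun y : Fin 3 → ℝ => c * fpChi ((81 / 20 * a) ^ 2) ((27 / 5 * a) ^ 2) (y - y₀) ^ 2 * (fpSq (y - y₀))⁻¹ ^ 4)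
      (p1RealCell a h T) volume := hωc.continuousOn.integrableOn_compact hK
  have hmono := setIntegral_mono_on hint4 hint3 hmeas hpt
  rw [integral_const_mul] at hmono
  have hJ : (∫ y in p1RealCell a h T, fpChi ((81 / 20 * a) ^ 2) ((27 / 5 * a) ^ 2) (y - y₀) ^ 2 * (fpSq (y - y₀))⁻¹ ^ 3) =
      p1CellJ a h p T := rfl
  rw [hJ] at hmono
  have hJ0 := p1CellJ_nonneg a h p T
  have hF0 : 0 ≤ fpFrob G := by unfold fpFrob; positivity
  calc p1CellDefectG a h W T G ≤ (∫ y in p1RealCell a h T, c * fpChi ((81 / 20 * a) ^ 2) ((27 / 5 * a) ^ 2) (y - y₀) ^ 2 *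
        (fpSq (y - y₀))⁻¹ ^ 4) * ((a ^ 2 / 3 + h ^ 2 / 4) * fpFrob G) := hdef
    _ ≤ (c / ((R - 3 / 2) ^ 2 * a ^ 2) * p1CellJ a h p T) * ((a ^ 2 / 3 + h ^ 2 / 4) * fpFrob G) :=
        mul_le_mul_of_nonneg_right hmono (by positivity)
    _ = c * (a ^ 2 / 3 + h ^ 2 / 4) / ((R - 3 / 2) ^ 2 * a ^ 2) * fpFrob G * p1CellJ a h p T := by
        rw [div_eq_mul_inv, div_eq_mul_inv]; ring

/-- **A cell that carries NO load satisfies the budget by its defect alone — every cell, any position.**  The radial weight has the factor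
`χ²`, which vanishes for `s ≤ (81a/20)²`, so pointwise `cχ²s⁻⁴ ≤ (c/(81a/20)²)·χ²s⁻³`; with the circumradius table (`ρ_T ≤ a²/3 + h²/4`):
`defect_T ≤ κ(19/8)(a²/3 + h²/4)/((81/20)²a²)·|G|²_F·J_T ≤ 0.1118·|G|²_F·J_T ≤ κ(5/48)·|G|²_F·J_T`.  (Closes the budget for the cells the
per-cell certifier does not list: those inside the `χ = 0` ball and the slivers poking out of it by one vertex, HOME CERT §39.) [folklore] -/
theorem defect_only_budget {a h : ℝ} (ha : 0 < a) (hh : 0 < h) (hha : h ≤ 9 / 10 * a) (hah : 4 / 5 * a ≤ h) (p : ℤ × ℤ × ℤ)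
    (T : (ℤ × ℤ × ℤ) × Fin 6) (G : Fin 3 → Fin 3 → ℝ) :
    p1CellDefectG a h (fun y k l => (193 / 125) * ((7 * (5 / 4 : ℝ) + 3 / 4) / 4) * fpChi ((81 / 20 * a) ^ 2) ((27 / 5 * a) ^ 2) (y - fun k => hcpSite a h p k) ^ 2 *
        (fpSq (y - fun k => hcpSite a h p k))⁻¹ ^ 5 * ((y - fun k => hcpSite a h p k) k * (y - fun k => hcpSite a h p k) l)) T G ≤
      (193 / 125) * ((5 / 2 * (1 / 24 * fpSymSq G) + 5 / 2 * (1 / 24 * (fpFrob G - fpSymSq G))) *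
        ∫ y in p1RealCell a h T, fpChi ((81 / 20 * a) ^ 2) ((27 / 5 * a) ^ 2) (y - fun k => hcpSite a h p k) ^ 2 * (fpSq (y - fun k => hcpSite a h p k))⁻¹ ^ 3) := by
  have hS1 : (0 : ℝ) < (81 / 20 * a) ^ 2 := by positivity
  have hS12 : (81 / 20 * a) ^ 2 < (27 / 5 * a) ^ 2 := by nlinarith
  set c : ℝ := (193 / 125) * ((7 * (5 / 4 : ℝ) + 3 / 4) / 4) with hc_def
  have hc : 0 ≤ c := by rw [hc_def]; norm_num
  set y₀ : Fin 3 → ℝ := fun k => hcpSite a h p k with hy₀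
  set W : (Fin 3 → ℝ) → Fin 3 → Fin 3 → ℝ := fun y k l => c * fpChi ((81 / 20 * a) ^ 2) ((27 / 5 * a) ^ 2) (y - y₀) ^ 2 *
    (fpSq (y - y₀))⁻¹ ^ 5 * ((y - y₀) k * (y - y₀) l) with hW
  have hWc : ∀ k l, Continuous fun y => W y k l := continuous_radWeight_translate hS1 hS12 c y₀
  have hW0 : ∀ y ∈ p1RealCell a h T, ∀ u, 0 ≤ p1Quad3 (W y) u := fun y _ u => p1Quad3_radWeight_nonneg hc _ _ (y - y₀) u
  have hωc := continuous_bareMajorant_translate hS1 hS12 c y₀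
  have hω : ∀ y ∈ p1RealCell a h T, ∀ u : Fin 3 → ℝ, p1Quad3 (W y) u ≤
      (c * fpChi ((81 / 20 * a) ^ 2) ((27 / 5 * a) ^ 2) (y - y₀) ^ 2 * (fpSq (y - y₀))⁻¹ ^ 4) * (u 0 ^ 2 + u 1 ^ 2 + u 2 ^ 2) :=
    fun y _ u => p1Quad3_radWeight_le hc _ _ (y - y₀) u
  obtain ⟨cc, hcc⟩ := exists_p1CellCenter a h hh.ne' T
  have hρ : ∀ m : Fin 4, fpSq (fun k => hcpSite a h (T.1 + p1VertOff (p1Par T.1) T.2 m) k - cc k) ≤ a ^ 2 / 3 + h ^ 2 / 4 := by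
    intro m
    refine (hcc m).trans ?_
    split_ifs
    · have hz : ((h ^ 2 - a ^ 2 / 3) / (2 * h)) ^ 2 ≤ h ^ 2 / 4 := by
        rw [div_pow, div_le_div_iff₀ (by positivity) (by positivity)]
        have h1 : 0 ≤ h ^ 2 - a ^ 2 / 3 := by nlinarith
        have h2 : h ^ 2 - a ^ 2 / 3 ≤ h ^ 2 := by nlinarith
        nlinarith [mul_le_mul h2 h2 h1 (by positivity)]
      linarith
    · exact le_rfl
  have hdef := p1CellDefectG_le_rad ha hh T W hWc hW0 hωc hω G hρ
  -- pointwise: `cχ²s⁻⁴ ≤ (c/S₁)·χ²s⁻³` (χ = 0 below S₁)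
  have hK := isCompact_p1RealCell ha.ne' hh.ne' T
  have hmeas : MeasurableSet (p1RealCell a h T) := (isClosed_p1RealCell a h T).measurableSet
  have hpt : ∀ y ∈ p1RealCell a h T, c * fpChi ((81 / 20 * a) ^ 2) ((27 / 5 * a) ^ 2) (y - y₀) ^ 2 * (fpSq (y - y₀))⁻¹ ^ 4 ≤
      c / (81 / 20 * a) ^ 2 * (fpChi ((81 / 20 * a) ^ 2) ((27 / 5 * a) ^ 2) (y - y₀) ^ 2 * (fpSq (y - y₀))⁻¹ ^ 3) := by
    intro y _
    by_cases hs : fpSq (y - y₀) ≤ (81 / 20 * a) ^ 2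
    · rw [fpChi_eq_zero hS12 hs]; simp
    · have hs' : (81 / 20 * a) ^ 2 ≤ fpSq (y - y₀) := le_of_lt (lt_of_not_ge hs)
      have hpos : 0 < fpSq (y - y₀) := lt_of_lt_of_le hS1 hs'
      have hinv : (fpSq (y - y₀))⁻¹ ≤ ((81 / 20 * a) ^ 2)⁻¹ := by rw [inv_le_inv₀ hpos hS1]; exact hs'
      have hχ0 : 0 ≤ c * fpChi ((81 / 20 * a) ^ 2) ((27 / 5 * a) ^ 2) (y - y₀) ^ 2 * (fpSq (y - y₀))⁻¹ ^ 3 := by positivity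
      calc c * fpChi ((81 / 20 * a) ^ 2) ((27 / 5 * a) ^ 2) (y - y₀) ^ 2 * (fpSq (y - y₀))⁻¹ ^ 4
          = (c * fpChi ((81 / 20 * a) ^ 2) ((27 / 5 * a) ^ 2) (y - y₀) ^ 2 * (fpSq (y - y₀))⁻¹ ^ 3) * (fpSq (y - y₀))⁻¹ := by ring
        _ ≤ (c * fpChi ((81 / 20 * a) ^ 2) ((27 / 5 * a) ^ 2) (y - y₀) ^ 2 * (fpSq (y - y₀))⁻¹ ^ 3) * ((81 / 20 * a) ^ 2)⁻¹ :=
            mul_le_mul_of_nonneg_left hinv hχ0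
        _ = c / (81 / 20 * a) ^ 2 * (fpChi ((81 / 20 * a) ^ 2) ((27 / 5 * a) ^ 2) (y - y₀) ^ 2 * (fpSq (y - y₀))⁻¹ ^ 3) := by
            rw [div_eq_mul_inv]; ring
  have hint3 : IntegrableOn (fun y : Fin 3 → ℝ => c / (81 / 20 * a) ^ 2 *
      (fpChi ((81 / 20 * a) ^ 2) ((27 / 5 * a) ^ 2) (y - y₀) ^ 2 * (fpSq (y - y₀))⁻¹ ^ 3)) (p1RealCell a h T) volume :=
    (continuous_const.mul (continuous_capIntegrand ha y₀)).continuousOn.integrableOn_compact hK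
  have hint4 : IntegrableOn (fun y : Fin 3 → ℝ => c * fpChi ((81 / 20 * a) ^ 2) ((27 / 5 * a) ^ 2) (y - y₀) ^ 2 * (fpSq (y - y₀))⁻¹ ^ 4)
      (p1RealCell a h T) volume := hωc.continuousOn.integrableOn_compact hK
  have hmono := setIntegral_mono_on hint4 hint3 hmeas hpt
  rw [integral_const_mul] at hmono
  have hJ : (∫ y in p1RealCell a h T, fpChi ((81 / 20 * a) ^ 2) ((27 / 5 * a) ^ 2) (y - y₀) ^ 2 * (fpSq (y - y₀))⁻¹ ^ 3) =
      p1CellJ a h p T := rfl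
  rw [hJ] at hmono ⊢
  have hJ0 := p1CellJ_nonneg a h p T
  have hF0 : 0 ≤ fpFrob G := by unfold fpFrob; positivity
  -- the constant: c·(a²/3 + h²/4)/((81/20)²a²) ≤ κ·5/48
  have hconst : c / (81 / 20 * a) ^ 2 * (a ^ 2 / 3 + h ^ 2 / 4) ≤ 193 / 125 * (5 / 48) := by
    rw [hc_def, div_mul_eq_mul_div, div_le_iff₀ hS1]
    nlinarith [pow_le_pow_left₀ hh.le hha 2]
  calc p1CellDefectG a h W T G ≤ (∫ y in p1RealCell a h T, c * fpChi ((81 / 20 * a) ^ 2) ((27 / 5 * a) ^ 2) (y - y₀) ^ 2 *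
        (fpSq (y - y₀))⁻¹ ^ 4) * ((a ^ 2 / 3 + h ^ 2 / 4) * fpFrob G) := hdef
    _ ≤ (c / (81 / 20 * a) ^ 2 * p1CellJ a h p T) * ((a ^ 2 / 3 + h ^ 2 / 4) * fpFrob G) :=
        mul_le_mul_of_nonneg_right hmono (by positivity)
    _ = (c / (81 / 20 * a) ^ 2 * (a ^ 2 / 3 + h ^ 2 / 4)) * (fpFrob G * p1CellJ a h p T) := by ring
    _ ≤ (193 / 125 * (5 / 48)) * (fpFrob G * p1CellJ a h p T) := mul_le_mul_of_nonneg_right hconst (mul_nonneg hF0 hJ0)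
    _ = (193 / 125) * ((5 / 2 * (1 / 24 * fpSymSq G) + 5 / 2 * (1 / 24 * (fpFrob G - fpSymSq G))) * p1CellJ a h p T) := by ring

end Summit.AtomisticToContinuum.Crystallization.Theorems.StrictSplittingRuleBirth

end
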